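import Summits.NavierStokesRegularity.NavierStokesRegularity.Theorems.ExtremiserTransienceZoneTransversalityDefs
import Summits.NavierStokesRegularity.NavierStokesRegularity.Theorems.ExtremiserTransienceKStarAttainedHalfSpaceVariation
import Literature.Analysis.FluidPDE.TypeIAncientMild
import HarnessLib

/-!
# Route `ExtremiserTransience`, crux `NearExtremalTransiencePerFlow` (stmt-NavierStokesRegularity-26567),
# LINE g7-δ «coherent member selection»: THE VOCABULARY OF STUB T2 `ZoomPackage` (texts of record)

Texts of record, VERBATIM §0–§1 of the published line `Cruxes/NearExtremalTransiencePerFlow/Lines/member_selection.lean`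
(planner ns-idea-5 g7; PASS idea-crit-4 2026-08-28; not the registered skeleton of record), restricted to what T2 needs, so that
T2 can be stated BY NAME in a Theorems file (a `Cruxes/` file is not importable from `Theorems/`):
* `EfficientTimesData ν T u Θ t Mb ε` — late times `t n → T`, height bounds `Mb n`, deficits `ε n → 0`, non-trivial budgets,
  near-efficiency at height `Mb n`, and the Taylor bound `Z ≤ Θ·ν(T − t n)·P`;
* `NearExtremalFamily v Λ Θ ε` — a height-1 near-extremal family with uniform `Cᵏ` bounds `Λ k`, finite budgets, deficits `ε n → 0`
  and Taylor bound `Z ≤ Θ P`;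
* `ZoomCompact v` — along any centres and subsequence a further subsequence of translates converges pointwise to a slice `W s`,
  `s < 0`, of a Type-I ancient mild field;
* `ZoomPackage` — T2 itself (PROVED in the companion file `…MemberSelectionStubZoomPackage`).
The violator frame `IsViolator` (with `PFC`) is the landed, byte-identical text of record
`…Theorems.NearExtremalTransiencePerFlow.ZoneTransversality.IsViolator` (file `ExtremiserTransienceZoneTransversalityDefs`), reused.
All bodies are the line's, so the line's `stub_zoomPackage : ZoomPackage` closes by `exact` (definitional unfolding).
Author: prover seat `ns-net-p2` (g0). HONEST FRAMING: definitions only; nothing about Navier–Stokes regularity or blow-up is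
proved; no summit is proved by a line.
-/

noncomputable section

open scoped Topology InnerProductSpace RealInnerProductSpace ENNReal ContDiff
open MeasureTheory Filter Set Metric
open Literature.Analysis.FluidPDE
open Summit.NavierStokesRegularity.NavierStokesRegularity.Theorems.DepletionLadder.KStar.HalfSpace
open Summit.NavierStokesRegularity.NavierStokesRegularity.Theorems.NearExtremalTransiencePerFlow.ZoneTransversality

namespace Summit.NavierStokesRegularity.NavierStokesRegularity.Theorems.NearExtremalTransiencePerFlow.MemberSelection

-- the problem directory repeats the summit name (`NavierStokesRegularity/NavierStokesRegularity`)
set_option linter.dupNamespace false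

/-- EFFICIENT-TIMES DATA WITH A TAYLOR BOUND for the flow `u` (viscosity `ν`, singular time `T`): late times `t n → T`,
height bounds `Mb n ≥ ‖u (t n)‖_∞`, efficiency deficits `ε n → 0` (`(κ⋆ - ε n)·Mb n·√Z·√P ≤ |J(u (t n))|`, which pins `Mb n`
to the true height up to the factor `κ⋆/(κ⋆-ε n)`), non-trivial budgets, and the TAYLOR BOUND `Z(t n) ≤ Θ·ν(T - t n)·P(t n)`
(dissipation length `λ² = Z/P` at most parabolic — «no dust»). -/
def EfficientTimesData (ν T : ℝ) (u : ℝ → EuclideanSpace ℝ (Fin 3) → EuclideanSpace ℝ (Fin 3))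
    (Θ : ℝ) (t Mb ε : ℕ → ℝ) : Prop :=
  (∀ n, t n ∈ Set.Ico 0 T) ∧ Tendsto t atTop (𝓝 T) ∧ Tendsto ε atTop (𝓝 0) ∧ (∀ n, 0 < Mb n) ∧
    (∀ n x, ‖u (t n) x‖ ≤ Mb n) ∧
    (∀ n, 0 < Real.sqrt (∫ x, ‖curl (u (t n)) x‖ ^ 2) * Real.sqrt (∫ x, frobeniusNormSq (fderiv ℝ (curl (u (t n))) x))) ∧
    (∀ n, (kStar - ε n) * Mb n * Real.sqrt (∫ x, ‖curl (u (t n)) x‖ ^ 2) *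
        Real.sqrt (∫ x, frobeniusNormSq (fderiv ℝ (curl (u (t n))) x)) ≤
      |∫ x, ⟪curl (u (t n)) x, fderiv ℝ (u (t n)) x (curl (u (t n)) x)⟫_ℝ|) ∧
    (∀ n, (∫ x, ‖curl (u (t n)) x‖ ^ 2) ≤ Θ * (ν * (T - t n)) * ∫ x, frobeniusNormSq (fderiv ℝ (curl (u (t n))) x))

/-- A NEAR-EXTREMAL FAMILY of height-`1` slices: smooth, divergence-free, `‖v n‖ ≤ 1`, ALL derivatives bounded uniformly in `n`
(`Λ k` for order `k`), finite `Ḣ¹, Ḣ²` budgets, non-trivial, efficiency deficit `ε n → 0` at height `1`, and the Taylor bound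
`Z ≤ Θ P`.  (Exactly what the NS-compatible blow-up zoom of a Type-I violator delivers at the times of `EfficientTimesData`, T2.) -/
def NearExtremalFamily (v : ℕ → EuclideanSpace ℝ (Fin 3) → EuclideanSpace ℝ (Fin 3)) (Λ : ℕ → ℝ) (Θ : ℝ) (ε : ℕ → ℝ) : Prop :=
  (∀ n, ContDiff ℝ (⊤ : ℕ∞) (v n)) ∧ (∀ n, Literature.Analysis.FluidPDE.VectorCalculus.IsDivFree (v n)) ∧ (∀ n x, ‖v n x‖ ≤ 1) ∧
    (∀ (k : ℕ) n x, ‖iteratedFDeriv ℝ k (v n) x‖ ≤ Λ k) ∧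
    (∀ n, (∫⁻ x, ‖iteratedFDeriv ℝ 1 (v n) x‖ₑ ^ 2 < ⊤) ∧ (∫⁻ x, ‖iteratedFDeriv ℝ 2 (v n) x‖ₑ ^ 2 < ⊤)) ∧
    Tendsto ε atTop (𝓝 0) ∧
    (∀ n, 0 < Real.sqrt (∫ x, ‖curl (v n) x‖ ^ 2) * Real.sqrt (∫ x, frobeniusNormSq (fderiv ℝ (curl (v n)) x))) ∧
    (∀ n, (kStar - ε n) * Real.sqrt (∫ x, ‖curl (v n) x‖ ^ 2) * Real.sqrt (∫ x, frobeniusNormSq (fderiv ℝ (curl (v n)) x)) ≤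
      |∫ x, ⟪curl (v n) x, fderiv ℝ (v n) x (curl (v n) x)⟫_ℝ|) ∧
    (∀ n, (∫ x, ‖curl (v n) x‖ ^ 2) ≤ Θ * ∫ x, frobeniusNormSq (fderiv ℝ (curl (v n)) x))

/-- ZOOM COMPACTNESS of a family of slices: along ANY centres `y n` and ANY subsequence `φ`, a further subsequence of the translates
`v (φ (ψ n)) (y (φ (ψ n)) + ·)` converges pointwise to a slice `W s`, `s < 0`, of a Type-I ANCIENT MILD field
(`IsTypeIAncientMild K W`: smooth on `(-∞,0) × ℝ³`, divergence-free, Oseen-mild between all `s < t < 0`, `‖W t‖_∞ ≤ K/√(-t)`). -/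
def ZoomCompact (v : ℕ → EuclideanSpace ℝ (Fin 3) → EuclideanSpace ℝ (Fin 3)) : Prop :=
  ∀ (y : ℕ → EuclideanSpace ℝ (Fin 3)) (φ : ℕ → ℕ), StrictMono φ →
    ∃ (ψ : ℕ → ℕ) (K s : ℝ) (W : ℝ → EuclideanSpace ℝ (Fin 3) → EuclideanSpace ℝ (Fin 3)), StrictMono ψ ∧
      Literature.Analysis.FluidPDE.IsTypeIAncientMild K W ∧ s < 0 ∧
      ∀ z, Tendsto (fun n => v (φ (ψ n)) (y (φ (ψ n)) + z)) atTop (𝓝 (W s z))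

/-- (T2 — glue on landed KNSS compactness, parabolic regularity and Type-I inheritance) ZOOM PACKAGE: for a violator flow with
efficient-times data, the NS-COMPATIBLE zoomed slices `v n y := (Mb n)⁻¹ • u (t n) ((ν / Mb n) • y)` (height `1`, length `ν/Mb n`,
so that `(s,y) ↦ (Mb n)⁻¹ u(t n + (ν/(Mb n)²) s, (ν/Mb n) y)` is a unit-viscosity solution with `v n` as its time-`0` slice and blow-up
at `s = (Mb n)² (T - t n)/ν ∈ [c₀², C²(1+o(1))]`) form, along a subsequence `σ` (late times: the zoomed solution exists on `s ∈ [-1,0]` and `(Mb n)²(T-t n)/ν` converges), a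
near-extremal family (efficiency is invariant under the zoom; `Z ≤ Θ' P` with `Θ' = Θ·sup (Mb n)²(T-t n)/ν`) and are zoom-compact (KNSS 2009 Prop. 4.1 / Lemma 6.1, landed as
`Literature.Analysis.FluidPDE.KNSS2009_lemma61_ancientMild_of_oseenMild`, `isKNSSBlowupLimit_of_oseenMild_zoom_nearVertex`; Leray's
lower rate `lerayLowerRate_of_not_extends` keeps the vertex at `s* < 0`). -/
def ZoomPackage : Prop :=
  ∀ (C ν T : ℝ) (u : ℝ → EuclideanSpace ℝ (Fin 3) → EuclideanSpace ℝ (Fin 3)) (p : ℝ → EuclideanSpace ℝ (Fin 3) → ℝ),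
    IsViolator C ν T u p → ∀ (Θ : ℝ) (t Mb ε : ℕ → ℝ), EfficientTimesData ν T u Θ t Mb ε →
      ∃ (σ : ℕ → ℕ) (Λ : ℕ → ℝ) (Θ' : ℝ) (ε' : ℕ → ℝ), StrictMono σ ∧
        NearExtremalFamily (fun n y => (Mb (σ n))⁻¹ • u (t (σ n)) ((ν / Mb (σ n)) • y)) Λ Θ' ε' ∧
        ZoomCompact (fun n y => (Mb (σ n))⁻¹ • u (t (σ n)) ((ν / Mb (σ n)) • y))

end Summit.NavierStokesRegularity.NavierStokesRegularity.Theorems.NearExtremalTransiencePerFlow.MemberSelection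

end
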